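import Mathlib
import HarnessLib
import Literature.NumberTheory.Automorphic.HilbertSiegelModularFormModN
import Literature.NumberTheory.Automorphic.Paramodular.ParamodularGroup

/-!
# Siegel paramodular forms of degree two: `M_k(K(N))`, `S_k(K(N))`, the Hecke operators `T(p)`,
# `T₁(p²)` and the spinor Euler factor `Q_p(f,T)`

The automorphic vocabulary of the paramodularity statements "L_p(A,T) = Q_p(f,T) for all p" of
Brumer–Pacetti–Poor–Tornaría–Voight–Yuen [BrumerEtAl2019, Thm 7.1.3 / 7.2.1 / 7.3.1], transcribed
from [BrumerEtAl2019, §4.2, (4.2.1)–(4.2.18)] (who follow Freitag). Degree `2`, base field `ℚ`,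
scalar weight `k`, level the paramodular group `K(N)` of `ParamodularGroup.lean`.

## Contents (each item states what is printed and where)
* `moeb M Z = (AZ+B)(CZ+D)⁻¹`, `autFactor M Z = det(CZ+D)` for `M = (A B; C D) ∈ M₄(ℚ)` acting on
  `Z ∈ M₂(ℂ)` — junk off the Siegel upper half space `ℍ₂ = siegelUpperHalfSpace 2` (the tree's).
* `slash k μ M f` — the classical slash `(f|_k M)(Z) := μ^{2k-3} det(CZ+D)^{-k} f((AZ+B)(CZ+D)⁻¹)`
  of [BrumerEtAl2019, (4.2.1)] for `M ∈ GSp₄⁺(ℚ)` with similitude `μ` (`Mᵀ J' M = μ J'`). The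
  similitude is an explicit ARGUMENT (`μ = 1` on `K(N) ≤ Sp₄(ℚ)`, `μ = p` for the representatives
  of `T(p)`, `μ = p²` for those of `T₁(p²)`), so that no square root of `det M = μ²` is taken.
* `IsParamodularForm N k f` — `f ∈ M_k(K(N))` [BrumerEtAl2019, §4.2 display before (4.2.2)]:
  holomorphic on `ℍ₂`, `f|_k γ = f` on `ℍ₂` for `γ ∈ K(N)`, and (normalisation of junk) `f = 0` off
  `ℍ₂`. No growth condition (Koecher's principle in degree 2).
* `IsParamodularCuspForm N k f` — `f ∈ S_k(K(N))`, "the subspace of forms vanishing at the cusps"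
  [BrumerEtAl2019, §4.2]: Siegel's `Φ`-operator kills `f|_k g` for every `g ∈ Sp₄(ℚ)`.
* `heckeT k p f`, `heckeT1 k p f` — `f|_k T(p)` and `f|_k T₁(p²)` as the finite sums of slashes
  over the LEFT-COSET REPRESENTATIVES PRINTED in [BrumerEtAl2019, (4.2.8)] and
  [BrumerEtAl2019, Lemma 4.2.11, (4.2.12)] (for `p ∤ N`; `(1+p)(1+p²)` resp. `p(1+p)(1+p²)`
  terms, (4.2.14)).
* `IsHeckeEigenAt k p f a a₁` — `f|_k T(p) = a f` and `f|_k T₁(p²) = a₁ f` on `ℍ₂`;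
  `bp2 k p a₁ = p a₁ + p^{2k-5}(1+p²)` [BrumerEtAl2019, (4.2.16)];
  `spinorHeckePoly k p a b = 1 - aT + bT² - p^{2k-3} a T³ + p^{4k-6} T⁴` [BrumerEtAl2019, (4.2.18)]
  and `HasSpinorEulerFactorAt k p f Q` ("`Q = Q_p(f,T)`").

## Design notes
* As in `HilbertSiegelModularFormModN.lean`, forms are functions on all of `M₂(ℂ)` and holomorphy
  is `ℂ`-differentiability of `Z ↦ f (Matrix.of Z)` within the locus `ℍ₂ ⊆ Sym₂(ℂ)` of the `Pi`
  normed space `Fin 2 → Fin 2 → ℂ` (only canonical instances; see `IsHolomorphicOnH2`).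
* Weights are natural numbers; all exponents `2k-3`, `2k-5`, `4k-6`, `-k` are INTEGER powers
  (`zpow`), so nothing is truncated for small `k` (for `k = 2`: `p^{-1}` in (4.2.16) is honest).
* The Hecke sums are DEFINITIONS by the printed representatives; that they equal the double-coset
  operators `T(K(N) diag(1,1,p,p) K(N))`, `T(K(N) diag(1,p,p²,p) K(N))` for `p ∤ N` is
  [BrumerEtAl2019, (4.2.8)] resp. [BrumerEtAl2019, Lemma 4.2.11] (from Roberts–Schmidt (6.6)) and
  is not re-proved here.

## Not here
Newforms/oldforms and the Petersson product; Gritsenko lifts and "nonlift"; Arthur type (G)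
[BrumerEtAl2019, Prop 4.3.2]; the Galois representation `ρ_{f,ℓ}` [BrumerEtAl2019, Thm 4.3.4]
(a named fact for a later file); Fourier expansions (4.2.5) and the coefficient formulas (4.2.9),
(4.2.13); the Fricke involution and `S_k(K(N))^±`.
-/

open scoped Matrix

namespace Literature.NumberTheory.Automorphic.Paramodular

open HilbertSiegel

/-! ## The action on the Siegel upper half space and the slash operator -/

/-- The complexification `M ⊗ ℂ ∈ M₄(ℂ)` of a rational `4 × 4` matrix. [folklore] -/
noncomputable def toComplex (M : Matrix (Fin 2 ⊕ Fin 2) (Fin 2 ⊕ Fin 2) ℚ) :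
    Matrix (Fin 2 ⊕ Fin 2) (Fin 2 ⊕ Fin 2) ℂ :=
  M.map ((↑) : ℚ → ℂ)

/-- The linear fractional action `Z ↦ (AZ+B)(CZ+D)⁻¹` of `M = (A B; C D) ∈ M₄(ℚ)` on `M₂(ℂ)`
(`⁻¹ = Matrix.inv`; on the Siegel upper half space and for `M ∈ GSp₄⁺(ℚ)` the matrix `CZ+D` is
invertible and the value lies in `ℍ₂`; elsewhere the value is junk). [cite: BrumerEtAl2019, (4.2.1)] -/
noncomputable def moeb (M : Matrix (Fin 2 ⊕ Fin 2) (Fin 2 ⊕ Fin 2) ℚ) (Z : Matrix (Fin 2) (Fin 2) ℂ) :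
    Matrix (Fin 2) (Fin 2) ℂ :=
  ((toComplex M).toBlocks₁₁ * Z + (toComplex M).toBlocks₁₂) *
    ((toComplex M).toBlocks₂₁ * Z + (toComplex M).toBlocks₂₂)⁻¹

/-- The automorphy factor `det(CZ+D)` of `M = (A B; C D)` at `Z`. [cite: BrumerEtAl2019, (4.2.1)] -/
noncomputable def autFactor (M : Matrix (Fin 2 ⊕ Fin 2) (Fin 2 ⊕ Fin 2) ℚ)
    (Z : Matrix (Fin 2) (Fin 2) ℂ) : ℂ :=
  ((toComplex M).toBlocks₂₁ * Z + (toComplex M).toBlocks₂₂).det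

/-- **The classical slash operator in weight `k`** [BrumerEtAl2019, (4.2.1)]:
`(f|_k M)(Z) := μ^{2k-3} det(CZ+D)^{-k} f((AZ+B)(CZ+D)⁻¹)` for `M = (A B; C D) ∈ GSp₄⁺(ℚ)` of
similitude `μ` (i.e. `Mᵀ J' M = μ J'`, `μ = det(M)^{1/2} > 0`). The similitude `μ` is passed
explicitly (it is `1` on `Sp₄(ℚ) ⊇ K(N)`, `p` on the coset representatives of `T(p)` and `p²` on
those of `T₁(p²)`); the exponents `2k-3` and `-k` are integer powers.
[cite: BrumerEtAl2019, (4.2.1)] -/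
noncomputable def slash (k : ℕ) (μ : ℚ) (M : Matrix (Fin 2 ⊕ Fin 2) (Fin 2 ⊕ Fin 2) ℚ)
    (f : Matrix (Fin 2) (Fin 2) ℂ → ℂ) : Matrix (Fin 2) (Fin 2) ℂ → ℂ := fun Z =>
  (μ : ℂ) ^ (2 * (k : ℤ) - 3) * autFactor M Z ^ (-(k : ℤ)) * f (moeb M Z)

/-- Unfolding of the slash operator. [cite: BrumerEtAl2019, (4.2.1)] -/
theorem slash_apply (k : ℕ) (μ : ℚ) (M : Matrix (Fin 2 ⊕ Fin 2) (Fin 2 ⊕ Fin 2) ℚ)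
    (f : Matrix (Fin 2) (Fin 2) ℂ → ℂ) (Z : Matrix (Fin 2) (Fin 2) ℂ) :
    slash k μ M f Z = (μ : ℂ) ^ (2 * (k : ℤ) - 3) * autFactor M Z ^ (-(k : ℤ)) * f (moeb M Z) :=
  rfl

/-- The slash operator is additive in `f`. [folklore] -/
theorem slash_add (k : ℕ) (μ : ℚ) (M : Matrix (Fin 2 ⊕ Fin 2) (Fin 2 ⊕ Fin 2) ℚ)
    (f g : Matrix (Fin 2) (Fin 2) ℂ → ℂ) : slash k μ M (f + g) = slash k μ M f + slash k μ M g := by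
  funext Z; simp [slash, mul_add]

/-- The slash operator commutes with scalars. [folklore] -/
theorem slash_smul (k : ℕ) (μ : ℚ) (M : Matrix (Fin 2 ⊕ Fin 2) (Fin 2 ⊕ Fin 2) ℚ) (c : ℂ)
    (f : Matrix (Fin 2) (Fin 2) ℂ → ℂ) : slash k μ M (c • f) = c • slash k μ M f := by
  funext Z; simp [slash]; ring

/-! ## Paramodular forms and cusp forms -/

/-- Holomorphy on the Siegel upper half space `ℍ₂` of degree `2`: `ℂ`-differentiability of
`Z ↦ f (Matrix.of Z)` WITHIN the locus `{Z | Matrix.of Z ∈ ℍ₂}` of the `Pi` normed space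
`Fin 2 → Fin 2 → ℂ` (`DifferentiableOn`). Since `ℍ₂` consists of SYMMETRIC matrices, this locus is
a relatively open subset of the `3`-dimensional subspace `Sym₂(ℂ)`, not an open subset of `M₂(ℂ)`;
differentiability within it is differentiability along `Sym₂(ℂ)`, i.e. holomorphy in the three
free entries `z₁₁, z₁₂ = z₂₁, z₂₂` — the classical notion (same convention as the tree's
`HilbertSiegel.IsHolomorphicOn`). [folklore] -/
def IsHolomorphicOnH2 (f : Matrix (Fin 2) (Fin 2) ℂ → ℂ) : Prop :=
  DifferentiableOn ℂ (fun Z : Fin 2 → Fin 2 → ℂ => f (Matrix.of Z))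
    {Z | Matrix.of Z ∈ siegelUpperHalfSpace 2}

/-- **Siegel paramodular forms of weight `k` and level `N`**, `f ∈ M_k(K(N))`
[BrumerEtAl2019, §4.2]: `f : ℍ₂ → ℂ` holomorphic with `(f|_k γ)(Z) = f(Z)` for all `γ ∈ K(N)` and
`Z ∈ ℍ₂` (similitude `1`), realised as a function on all of `M₂(ℂ)` vanishing off `ℍ₂`
(normalisation of junk values, so that `M_k(K(N))` is an honest subspace of `M₂(ℂ) → ℂ`). No
condition at infinity is imposed: in degree `2` holomorphy at the cusps is automatic (Koecher's
principle). [cite: BrumerEtAl2019, §4.2] -/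
structure IsParamodularForm (N : ℕ) [NeZero N] (k : ℕ) (f : Matrix (Fin 2) (Fin 2) ℂ → ℂ) :
    Prop where
  holomorphic : IsHolomorphicOnH2 f
  transform : ∀ γ ∈ paramodularGroup N, ∀ Z ∈ siegelUpperHalfSpace 2,
    slash k 1 (γ : Matrix (Fin 2 ⊕ Fin 2) (Fin 2 ⊕ Fin 2) ℚ) f Z = f Z
  eq_zero : ∀ Z ∉ siegelUpperHalfSpace 2, f Z = 0

/-- The argument `diag(τ, it)` of Siegel's `Φ`-operator: `(Φ F)(τ) = lim_{t → +∞} F(diag(τ, it))`.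
[folklore] -/
noncomputable def phiArg (τ : ℂ) (t : ℝ) : Matrix (Fin 2) (Fin 2) ℂ :=
  !![τ, 0; 0, (t : ℂ) * Complex.I]

/-- **Paramodular cusp forms**, `f ∈ S_k(K(N)) ⊆ M_k(K(N))`, "the subspace of forms vanishing at
the cusps of `K(N)`" [BrumerEtAl2019, §4.2]: `f` is a paramodular form and Siegel's `Φ`-operator
annihilates every translate, `lim_{t→+∞} (f|_k g)(diag(τ, it)) = 0` for all `g ∈ Sp₄(ℚ)` and all
`τ` in the upper half plane (all boundary components of the Satake compactification are
`Sp₄(ℚ)`-translates of the standard ones; equivalently every Fourier coefficient `a(T; f|_k g)` with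
`det T = 0` vanishes). [cite: BrumerEtAl2019, §4.2] -/
structure IsParamodularCuspForm (N : ℕ) [NeZero N] (k : ℕ) (f : Matrix (Fin 2) (Fin 2) ℂ → ℂ) :
    Prop extends IsParamodularForm N k f where
  phi_eq_zero : ∀ g : Sp4 ℚ, ∀ τ : ℂ, 0 < τ.im →
    Filter.Tendsto (fun t : ℝ => slash k 1 (g : Matrix (Fin 2 ⊕ Fin 2) (Fin 2 ⊕ Fin 2) ℚ) f (phiArg τ t))
      Filter.atTop (nhds 0)

/-- The zero function is a paramodular form of every weight and level. [folklore] -/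
theorem IsParamodularForm.zero (N : ℕ) [NeZero N] (k : ℕ) :
    IsParamodularForm N k (0 : Matrix (Fin 2) (Fin 2) ℂ → ℂ) where
  holomorphic := differentiableOn_const 0
  transform γ _ Z _ := by simp [slash]
  eq_zero Z _ := rfl

/-! ## The Hecke operators `T(p)` and `T₁(p²)` by their printed coset representatives -/

/-- The `(1+p)(1+p²)` left-coset representatives of `K(N) diag(1,1,p,p) K(N)` printed in
[BrumerEtAl2019, (4.2.8)] (for `p ∤ N`), as a list of `4 × 4` rational matrices in block form
`(A B; C D)`: `diag(p,p,1,1)`; `(1 0 i 0; 0 p 0 0; 0 0 p 0; 0 0 0 1)` for `i mod p`;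
`(p 0 0 0; i 1 0 j; 0 0 1 -i; 0 0 0 p)` for `i, j mod p`; `(1 0 i j; 0 1 j k; 0 0 p 0; 0 0 0 p)`
for `i, j, k mod p` (representatives `0 ≤ i, j, k < p`). [cite: BrumerEtAl2019, (4.2.8)] -/
def heckeTReps (p : ℕ) : List (Matrix (Fin 2 ⊕ Fin 2) (Fin 2 ⊕ Fin 2) ℚ) :=
  [Matrix.fromBlocks !![(p : ℚ), 0; 0, p] 0 0 1] ++
  ((List.range p).map fun i =>
    Matrix.fromBlocks !![1, 0; 0, (p : ℚ)] !![(i : ℚ), 0; 0, 0] 0 !![(p : ℚ), 0; 0, 1]) ++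
  ((List.range p).flatMap fun i => (List.range p).map fun j =>
    Matrix.fromBlocks !![(p : ℚ), 0; (i : ℚ), 1] !![0, 0; 0, (j : ℚ)] 0 !![1, -(i : ℚ); 0, (p : ℚ)]) ++
  ((List.range p).flatMap fun i => (List.range p).flatMap fun j => (List.range p).map fun l =>
    Matrix.fromBlocks 1 !![(i : ℚ), (j : ℚ); (j : ℚ), (l : ℚ)] 0 !![(p : ℚ), 0; 0, (p : ℚ)])

/-- The number of printed representatives of `T(p)` is `deg T(p) = (1+p)(1+p²)`
[BrumerEtAl2019, (4.2.14)]. [cite: BrumerEtAl2019, (4.2.14)] -/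
theorem length_heckeTReps (p : ℕ) : (heckeTReps p).length = (1 + p) * (1 + p ^ 2) := by
  simp [heckeTReps, List.length_flatMap]
  ring

/-- **The Hecke operator `T(p) = T(K(N) diag(1,1,p,p) K(N))` on functions**, `f ↦ f|_k T(p) :=
∑_j f|_k M_j` over the printed left-coset representatives `M_j` of [BrumerEtAl2019, (4.2.8)]
(similitude `p`). Meaningful for `p` prime, `p ∤ N`, `f ∈ M_k(K(N))`.
[cite: BrumerEtAl2019, (4.2.7)–(4.2.8)] -/
noncomputable def heckeT (k p : ℕ) (f : Matrix (Fin 2) (Fin 2) ℂ → ℂ) :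
    Matrix (Fin 2) (Fin 2) ℂ → ℂ := fun Z =>
  ((heckeTReps p).map fun M => slash k p M f Z).sum

/-- The `p(1+p)(1+p²)` left-coset representatives of `K(N) diag(1,p,p²,p) K(N)` printed in
[BrumerEtAl2019, Lemma 4.2.11, (4.2.12)] (from Roberts–Schmidt (6.6); for `p ∤ N`):
`(p 0 0 0; 0 p² 0 0; 0 0 p 0; 0 0 0 1)`; `(p² 0 0 0; pi p 0 0; 0 0 1 -i; 0 0 0 p)` for `i mod p`;
`(p 0 i 0; 0 p 0 0; 0 0 p 0; 0 0 0 p)` for `i ≢ 0 mod p`; `(p 0 i²j ij; 0 p ij j; 0 0 p 0; 0 0 0 p)`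
for `i mod p`, `j ≢ 0 mod p`; `(1 0 j i; 0 p pi 0; 0 0 p² 0; 0 0 0 p)` for `i mod p`, `j mod p²`;
`(p 0 0 pj; i 1 j k; 0 0 p -pi; 0 0 0 p²)` for `i, j mod p`, `k mod p²` (representatives
`0 ≤ · < p` resp. `< p²`, and `1 ≤ · < p` for the nonzero classes). [cite: BrumerEtAl2019, (4.2.12)] -/
def heckeT1Reps (p : ℕ) : List (Matrix (Fin 2 ⊕ Fin 2) (Fin 2 ⊕ Fin 2) ℚ) :=
  [Matrix.fromBlocks !![(p : ℚ), 0; 0, (p : ℚ) ^ 2] 0 0 !![(p : ℚ), 0; 0, 1]] ++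
  ((List.range p).map fun i =>
    Matrix.fromBlocks !![(p : ℚ) ^ 2, 0; (p : ℚ) * i, (p : ℚ)] 0 0 !![1, -(i : ℚ); 0, (p : ℚ)]) ++
  (((List.range p).filter (· ≠ 0)).map fun i =>
    Matrix.fromBlocks !![(p : ℚ), 0; 0, (p : ℚ)] !![(i : ℚ), 0; 0, 0] 0 !![(p : ℚ), 0; 0, (p : ℚ)]) ++
  ((List.range p).flatMap fun i => ((List.range p).filter (· ≠ 0)).map fun j =>
    Matrix.fromBlocks !![(p : ℚ), 0; 0, (p : ℚ)] !![(i : ℚ) ^ 2 * j, (i : ℚ) * j; (i : ℚ) * j, (j : ℚ)]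
      0 !![(p : ℚ), 0; 0, (p : ℚ)]) ++
  ((List.range p).flatMap fun i => (List.range (p ^ 2)).map fun j =>
    Matrix.fromBlocks !![1, 0; 0, (p : ℚ)] !![(j : ℚ), (i : ℚ); (p : ℚ) * i, 0] 0
      !![(p : ℚ) ^ 2, 0; 0, (p : ℚ)]) ++
  ((List.range p).flatMap fun i => (List.range p).flatMap fun j => (List.range (p ^ 2)).map fun l =>
    Matrix.fromBlocks !![(p : ℚ), 0; (i : ℚ), 1] !![0, (p : ℚ) * j; (j : ℚ), (l : ℚ)] 0
      !![(p : ℚ), -((p : ℚ) * i); 0, (p : ℚ) ^ 2])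

/-- **The Hecke operator `T₁(p²) = T(K(N) diag(1,p,p²,p) K(N))` on functions**,
`f ↦ f|_k T₁(p²) := ∑_j f|_k M_j` over the printed left-coset representatives of
[BrumerEtAl2019, (4.2.12)] (similitude `p²`). Meaningful for `p` prime, `p ∤ N`, `f ∈ M_k(K(N))`.
[cite: BrumerEtAl2019, (4.2.10)–(4.2.12)] -/
noncomputable def heckeT1 (k p : ℕ) (f : Matrix (Fin 2) (Fin 2) ℂ → ℂ) :
    Matrix (Fin 2) (Fin 2) ℂ → ℂ := fun Z =>
  ((heckeT1Reps p).map fun M => slash k ((p : ℚ) ^ 2) M f Z).sum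

/-! ## Eigenvalues and the spinor Euler factor -/

/-- `f` is an eigenfunction of `T(p)` and `T₁(p²)` with eigenvalues `a = a_p(f)` and
`a₁ = a_{1,p²}(f)`: `f|_k T(p) = a f` and `f|_k T₁(p²) = a₁ f` on `ℍ₂`
[BrumerEtAl2019, text before (4.2.16)]. [cite: BrumerEtAl2019, (4.2.16)] -/
def IsHeckeEigenAt (k p : ℕ) (f : Matrix (Fin 2) (Fin 2) ℂ → ℂ) (a a₁ : ℂ) : Prop :=
  (∀ Z ∈ siegelUpperHalfSpace 2, heckeT k p f Z = a * f Z) ∧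
  (∀ Z ∈ siegelUpperHalfSpace 2, heckeT1 k p f Z = a₁ * f Z)

/-- The eigenvalue `b_{p²}(f) := p a_{1,p²}(f) + p^{2k-5}(1+p²)` of the operator
`B(p²) = p(T₁(p²) + (1+p²)T₂(p²))`, `T₂(p²) = p^{2k-6} id` [BrumerEtAl2019, (4.2.15)–(4.2.16)]
(integer power: for `k = 2` this is `p a₁ + (1+p²)/p`, an integer when `f` has integral Fourier
coefficients, Lemma 4.2.17). [cite: BrumerEtAl2019, (4.2.16)] -/
noncomputable def bp2 (k p : ℕ) (a₁ : ℂ) : ℂ :=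
  (p : ℂ) * a₁ + (p : ℂ) ^ (2 * (k : ℤ) - 5) * (1 + (p : ℂ) ^ 2)

/-- **The spinor Hecke polynomial / spinor Euler factor in the arithmetic normalisation**
[BrumerEtAl2019, (4.2.18)] (Roberts–Schmidt):
`Q_p(f,T) := 1 - a_p(f) T + b_{p²}(f) T² - p^{2k-3} a_p(f) T³ + p^{4k-6} T⁴`, as a polynomial in
`T` with complex coefficients, given the weight `k`, the prime `p` and the two numbers
`a = a_p(f)`, `b = b_{p²}(f)`. [cite: BrumerEtAl2019, (4.2.18)] -/
noncomputable def spinorHeckePoly (k p : ℕ) (a b : ℂ) : Polynomial ℂ :=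
  1 - Polynomial.C a * Polynomial.X + Polynomial.C b * Polynomial.X ^ 2
    - Polynomial.C ((p : ℂ) ^ (2 * (k : ℤ) - 3) * a) * Polynomial.X ^ 3
    + Polynomial.C ((p : ℂ) ^ (4 * (k : ℤ) - 6)) * Polynomial.X ^ 4

/-- In weight `2` the spinor Euler factor reads `1 - aT + bT² - p a T³ + p² T⁴` (the shape of
`L_p(A,T)` of an abelian surface, [BrumerEtAl2019, (4.1.5)]). [cite: BrumerEtAl2019, (4.2.18)] -/
theorem spinorHeckePoly_two (p : ℕ) (a b : ℂ) :
    spinorHeckePoly 2 p a b = 1 - Polynomial.C a * Polynomial.X + Polynomial.C b * Polynomial.X ^ 2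
      - Polynomial.C ((p : ℂ) * a) * Polynomial.X ^ 3 + Polynomial.C ((p : ℂ) ^ 2) * Polynomial.X ^ 4 := by
  simp only [spinorHeckePoly]
  norm_num [zpow_ofNat]

/-- "`Q` is the spinor Euler factor `Q_p(f,T)` of `f` at `p`": `f` is a `T(p)`-, `T₁(p²)`-eigen-
function with some eigenvalues `a`, `a₁` and `Q = 1 - aT + b_{p²}T² - p^{2k-3}aT³ + p^{4k-6}T⁴`
with `b_{p²} = p a₁ + p^{2k-5}(1+p²)`. This is the automorphic side of the equalities
`L_p(A,T) = Q_p(f,T)` [BrumerEtAl2019, Thm 7.1.3]. [cite: BrumerEtAl2019, (4.2.18)] -/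
def HasSpinorEulerFactorAt (k p : ℕ) (f : Matrix (Fin 2) (Fin 2) ℂ → ℂ) (Q : Polynomial ℂ) : Prop :=
  ∃ a a₁ : ℂ, IsHeckeEigenAt k p f a a₁ ∧ Q = spinorHeckePoly k p a (bp2 k p a₁)

/-- If `f` is not annihilated on `ℍ₂` the eigenvalues, hence the spinor Euler factor, are
determined by `f`: two spinor Euler factors of the same `f ≢ 0` at `p` coincide. [folklore] -/
theorem HasSpinorEulerFactorAt.unique {k p : ℕ} {f : Matrix (Fin 2) (Fin 2) ℂ → ℂ}
    {Q Q' : Polynomial ℂ} (hQ : HasSpinorEulerFactorAt k p f Q)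
    (hQ' : HasSpinorEulerFactorAt k p f Q') (hf : ∃ Z ∈ siegelUpperHalfSpace 2, f Z ≠ 0) :
    Q = Q' := by
  obtain ⟨a, a₁, ⟨ha, ha₁⟩, rfl⟩ := hQ
  obtain ⟨a', a₁', ⟨ha', ha₁'⟩, rfl⟩ := hQ'
  obtain ⟨Z, hZ, hfZ⟩ := hf
  have h1 : a = a' := mul_right_cancel₀ hfZ ((ha Z hZ).symm.trans (ha' Z hZ))
  have h2 : a₁ = a₁' := mul_right_cancel₀ hfZ ((ha₁ Z hZ).symm.trans (ha₁' Z hZ))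
  rw [h1, h2]

end Literature.NumberTheory.Automorphic.Paramodular
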